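import Literature.AnabelianGeometry.EtaleTheta.ContH1ConjAction
import Mathlib.Topology.Algebra.OpenSubgroup
import HarnessLib

/-!
# The conjugation action on continuous cocycles is LOCALLY CONSTANT modulo every open normal subgroup of a
# profinite coefficient group (support file for [EtTh] §1, Rmk 1.6.4 (c2) in its `Ẑ`-form)

Neukirch–Schmidt–Wingberg, *Cohomology of Number Fields*, I §5 (the conjugation action `(σ·f)(h) = σ f(σ⁻¹hσ) σ⁻¹` on
cochains; continuity of the action of a profinite group on the cohomology of a closed normal subgroup with profinite
coefficients) [cite: NeukirchSchmidtWingberg2008, I §5]; used for Mochizuki, *The étale theta function …*, Publ. RIMS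
**45** (2009) [EtTh], Remark 1.6.4 p. 252 («on which any `Π_X/Π_{Y^∧} ≅ Ẑ ∋ a` acts via …») [cite: MochizukiEtTh2009, Rmk 1.6.4 p.252]
— the passage from the tempered `a ∈ ℤ` (deck transformations, dense in `Ẑ`) to all `a ∈ Ẑ` (abc-iut VNEXT
«RMK164-(c2)-ZHAT», piece (Z4) of abc-iut-f-128's topology-free route; (Z2) = `ContH1Separated.lean`).

PROOF-ONLY (abc-iut cell, prover abc-iut-f-128 gen 8; generic `ContH1` API over abc-iut-L2-t1's carrier and
abc-iut-L2-t6's `ContH1ConjAction`; no definitions, no facts).  Setting: `φ : G → G′` CONTINUOUS into a topological group,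
`A ⊴ G′` abelian normal with COMPACT carrier, `H ⊴ G` normal with COMPACT carrier, `f` a continuous cocycle on `H`.
* `exists_nhds_forall_conj_mul_inv_mem` — uniform continuity of conjugation on the compact `A`: for an open normal
  `N ⊴ G′` there is a neighbourhood `V` of `1` in `G` with `φ(g) a φ(g)⁻¹ a⁻¹ ∈ N` for all `g ∈ V`, `a ∈ A` (tube lemma);
* `exists_nhds_forall_apply_conj_congr` — uniform continuity of `f ∘ (inner)` on the compact `H`: a neighbourhood `V` of
  `1` with `f(g⁻¹ h g) ≡ f(h) (mod N)` for all `g ∈ V`, `h ∈ H`;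
* `ContH1.exists_nhds_forall_conjCocycle_congr` — **the conjugate cocycle `g·f` is congruent to `f` modulo `N`,
  pointwise on `H`, for all `g` in a neighbourhood of `1`**; `…_conjCocycle_mul_congr` — the same around any `g₀`
  (`(g g₀)·f ≡ g₀·f (mod N)` for `g` near `1`): the action is locally constant modulo `N`.
Mathlib only.  Nothing here bears on [IUTchIII] Cor. 3.12; the [EtTh] assembly is not made here.
-/

noncomputable section

namespace Literature.AnabelianGeometry.EtaleTheta

open scoped IsMulCommutative
open Topology

namespace ContH1

variable {G G' : Type*} [Group G] [TopologicalSpace G] [IsTopologicalGroup G]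
  [Group G'] [TopologicalSpace G'] [IsTopologicalGroup G']
  {φ : G →* G'} {A : Subgroup G'} [A.Normal] [IsMulCommutative A] {H : Subgroup G} [H.Normal]

omit [IsTopologicalGroup G] [A.Normal] [IsMulCommutative A] [H.Normal] in
/-- **Uniform continuity of conjugation on a compact coefficient group**: for `φ : G → G′` continuous, `A ⊴ G′` with
compact carrier and an open normal `N ⊴ G′`, there is a neighbourhood `V` of `1` in `G` with
`φ(g) a φ(g)⁻¹ a⁻¹ ∈ N` for every `g ∈ V` and every `a ∈ A` (tube lemma for the continuous map
`(g, a) ↦ φ(g) a φ(g)⁻¹ a⁻¹`, which is `1` on `{1} × A`). [cite: NeukirchSchmidtWingberg2008, I §5] -/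
theorem exists_nhds_forall_conj_mul_inv_mem (hφ : Continuous φ) (hA : IsCompact (A : Set G'))
    (N : OpenNormalSubgroup G') :
    ∃ V ∈ 𝓝 (1 : G), ∀ g ∈ V, ∀ a : A, φ g * (a : G') * (φ g)⁻¹ * ((a : G'))⁻¹ ∈ N.toSubgroup := by
  haveI : CompactSpace A := isCompact_iff_compactSpace.mp hA
  let F : G × A → G' := fun q => φ q.1 * (q.2 : G') * (φ q.1)⁻¹ * ((q.2 : G'))⁻¹
  have hF : Continuous F := by
    have h1 : Continuous fun q : G × A => φ q.1 := hφ.comp continuous_fst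
    have h2 : Continuous fun q : G × A => ((q.2 : A) : G') := continuous_subtype_val.comp continuous_snd
    exact ((h1.mul h2).mul h1.inv).mul h2.inv
  have hopen : IsOpen (F ⁻¹' (N : Set G')) := N.toOpenSubgroup.isOpen.preimage hF
  have hsub : ({(1 : G)} : Set G) ×ˢ (Set.univ : Set A) ⊆ F ⁻¹' (N : Set G') := by
    rintro ⟨g, a⟩ ⟨hg, -⟩
    have hg1 : g = 1 := hg
    subst hg1
    show φ 1 * (a : G') * (φ 1)⁻¹ * ((a : G'))⁻¹ ∈ (N : Set G')
    simp only [map_one, one_mul, inv_one, mul_one, mul_inv_cancel]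
    exact N.toSubgroup.one_mem
  obtain ⟨u, v, hu, -, h1u, huniv, huv⟩ :=
    generalized_tube_lemma isCompact_singleton isCompact_univ hopen hsub
  refine ⟨u, hu.mem_nhds (h1u (Set.mem_singleton 1)), fun g hg a => ?_⟩
  have : (g, a) ∈ u ×ˢ v := ⟨hg, huniv (Set.mem_univ a)⟩
  exact huv this

omit [A.Normal] [IsMulCommutative A] in
/-- **Uniform continuity of a continuous cocycle under inner automorphisms near `1`**: for `H ⊴ G` normal with compact
carrier, a continuous `f : H → A` and an open normal `N ⊴ G′`, there is a neighbourhood `V` of `1` in `G` with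
`f(g⁻¹ h g) · f(h)⁻¹ ∈ N` for every `g ∈ V`, `h ∈ H` (tube lemma for `(g, h) ↦ f(g⁻¹hg) f(h)⁻¹`, which is `1` on
`{1} × H`). [cite: NeukirchSchmidtWingberg2008, I §5] -/
theorem exists_nhds_forall_apply_conj_congr (hH : IsCompact (H : Set G)) {f : H → A} (hf : Continuous f)
    (N : OpenNormalSubgroup G') :
    ∃ V ∈ 𝓝 (1 : G), ∀ g ∈ V, ∀ h : H,
      ((f (MulAut.conjNormal g⁻¹ h) : A) : G') * ((f h : A) : G')⁻¹ ∈ N.toSubgroup := by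
  haveI : CompactSpace H := isCompact_iff_compactSpace.mp hH
  -- `(g, h) ↦ g⁻¹ h g ∈ H` is continuous
  have hconj : Continuous fun q : G × H => (MulAut.conjNormal q.1⁻¹ q.2 : H) := by
    refine continuous_induced_rng.2 ?_
    have : (Subtype.val ∘ fun q : G × H => (MulAut.conjNormal q.1⁻¹ q.2 : H)) =
        fun q : G × H => q.1⁻¹ * (q.2 : G) * q.1⁻¹⁻¹ := by
      funext q
      simp
    rw [this]
    fun_prop
  let F : G × H → G' := fun q => ((f (MulAut.conjNormal q.1⁻¹ q.2) : A) : G') * ((f q.2 : A) : G')⁻¹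
  have hF : Continuous F := by
    have h1 : Continuous fun q : G × H => ((f (MulAut.conjNormal q.1⁻¹ q.2) : A) : G') :=
      continuous_subtype_val.comp (hf.comp hconj)
    have h2 : Continuous fun q : G × H => ((f q.2 : A) : G') :=
      continuous_subtype_val.comp (hf.comp continuous_snd)
    exact h1.mul h2.inv
  have hopen : IsOpen (F ⁻¹' (N : Set G')) := N.toOpenSubgroup.isOpen.preimage hF
  have hsub : ({(1 : G)} : Set G) ×ˢ (Set.univ : Set H) ⊆ F ⁻¹' (N : Set G') := by
    rintro ⟨g, h⟩ ⟨hg, -⟩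
    have hg1 : g = 1 := hg
    subst hg1
    show ((f (MulAut.conjNormal (1 : G)⁻¹ h) : A) : G') * ((f h : A) : G')⁻¹ ∈ (N : Set G')
    have : MulAut.conjNormal (1 : G)⁻¹ h = h := Subtype.ext (by simp)
    rw [this, mul_inv_cancel]
    exact N.toSubgroup.one_mem
  obtain ⟨u, v, hu, -, h1u, huniv, huv⟩ :=
    generalized_tube_lemma isCompact_singleton isCompact_univ hopen hsub
  refine ⟨u, hu.mem_nhds (h1u (Set.mem_singleton 1)), fun g hg h => ?_⟩
  have : (g, h) ∈ u ×ˢ v := ⟨hg, huniv (Set.mem_univ h)⟩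
  exact huv this

/-- **The conjugation action on continuous cocycles is locally constant modulo `N`** (near `1`): for `φ : G → G′`
continuous, `A ⊴ G′` abelian normal with compact carrier, `H ⊴ G` normal with compact carrier, a continuous cocycle
`f` on `H` and an open normal `N ⊴ G′`, there is a neighbourhood `V` of `1` in `G` such that for every `g ∈ V` the
conjugate cocycle `g·f` (`ContH1.conjCocycle`: `(g·f)(h) = φ(g) f(g⁻¹hg) φ(g)⁻¹`) is congruent to `f` modulo `N`,
POINTWISE on `H`:  `(g·f)(h) · f(h)⁻¹ ∈ N`.  (Product of the two uniform continuities above: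
`φ(g) f(y) φ(g)⁻¹ f(y)⁻¹ · f(y) f(h)⁻¹`, `y = g⁻¹hg`.) [cite: NeukirchSchmidtWingberg2008, I §5]
[cite: MochizukiEtTh2009, Rmk 1.6.4 p.252] -/
theorem exists_nhds_forall_conjCocycle_congr (hφ : Continuous φ) (hA : IsCompact (A : Set G'))
    (hH : IsCompact (H : Set G)) (f : contCocycles φ A H) (N : OpenNormalSubgroup G') :
    ∃ V ∈ 𝓝 (1 : G), ∀ g ∈ V, ∀ h : H,
      (((conjCocycle φ A g f).1 h : A) : G') * ((f.1 h : A) : G')⁻¹ ∈ N.toSubgroup := by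
  obtain ⟨V₁, hV₁, h₁⟩ := exists_nhds_forall_conj_mul_inv_mem (A := A) hφ hA N
  obtain ⟨V₂, hV₂, h₂⟩ := exists_nhds_forall_apply_conj_congr (A := A) hH f.2.1 N
  refine ⟨V₁ ∩ V₂, Filter.inter_mem hV₁ hV₂, fun g hg h => ?_⟩
  rw [conjCocycle_apply]
  set y : H := MulAut.conjNormal g⁻¹ h with hy
  have hstep : (((MulAut.conjNormal (φ g) (f.1 y) : A)) : G') * ((f.1 h : A) : G')⁻¹ =
      (φ g * ((f.1 y : A) : G') * (φ g)⁻¹ * ((f.1 y : A) : G')⁻¹) *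
        (((f.1 y : A) : G') * ((f.1 h : A) : G')⁻¹) := by
    simp only [MulAut.conjNormal_apply, mul_assoc, inv_mul_cancel_left]
  rw [hstep]
  exact N.toSubgroup.mul_mem (h₁ g hg.1 (f.1 y)) (h₂ g hg.2 h)

/-- **Locally constant around any `g₀`**: with the data above, for every `g₀ ∈ G` there is a neighbourhood `V` of `1`
such that `((g g₀)·f)(h) · ((g₀·f)(h))⁻¹ ∈ N` for all `g ∈ V`, `h ∈ H` (apply the previous statement to the cocycle
`g₀·f` and use `(g g₀)·f = g·(g₀·f)`). [cite: NeukirchSchmidtWingberg2008, I §5] -/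
theorem exists_nhds_forall_conjCocycle_mul_congr (hφ : Continuous φ) (hA : IsCompact (A : Set G'))
    (hH : IsCompact (H : Set G)) (f : contCocycles φ A H) (N : OpenNormalSubgroup G') (g₀ : G) :
    ∃ V ∈ 𝓝 (1 : G), ∀ g ∈ V, ∀ h : H,
      (((conjCocycle φ A (g * g₀) f).1 h : A) : G') * (((conjCocycle φ A g₀ f).1 h : A) : G')⁻¹ ∈
        N.toSubgroup := by
  obtain ⟨V, hV, hcongr⟩ := exists_nhds_forall_conjCocycle_congr hφ hA hH (conjCocycle φ A g₀ f) N
  refine ⟨V, hV, fun g hg h => ?_⟩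
  rw [conjCocycle_mul]
  exact hcongr g hg h

end ContH1

end Literature.AnabelianGeometry.EtaleTheta

end
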